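import Summits.BirchSwinnertonDyer.BirchSwinnertonDyer.Theorems.BiquadraticEisensteinDescentHeegnerTwistCouplingInSupplyQuarticPartnerDescentDual
import Summits.BirchSwinnertonDyer.BirchSwinnertonDyer.Theorems.BiquadraticEisensteinDescentHeegnerTwistCouplingInSupplyQuarticTwistCorner
import Summits.BirchSwinnertonDyer.BirchSwinnertonDyer.Theorems.BiquadraticEisensteinDescentHeegnerTwistCouplingInSupplyPartnerLadder
import Summits.BirchSwinnertonDyer.BirchSwinnertonDyer.Theorems.BiquadraticEisensteinDescentHeegnerTwistCouplingInSupplyThreeSquaresPinDual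
import HarnessLib

set_option linter.dupNamespace false -- `Summit.BirchSwinnertonDyer.BirchSwinnertonDyer.Theorems.…` (summit = sub)
set_option autoImplicit false

/-!
# Crux `HeegnerTwistCouplingInSupply` (stmt-BirchSwinnertonDyer-21381) — the QUARTIC `j = 1728` corner with a SYMBOLIC PARTNER, III:
# ★★ the partner ladder for `W_p⁻ : y² = x³ − p·x`, `p ≡ 7 (mod 8)`: any partner prime `r ≡ 5 (mod 8)` with `p ∈ 𝔽_r^{×2} ∖ 𝔽_r^{×4}`

Route `BiquadraticEisensteinDescent` (cell `pub/bsd-wall`, width seat `bsd-wall-cm-bed-w4` g13; `--supports` 21381, helper).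
Generalises `…QuarticTwistCorner` (partner `5`, `p ≡ 4 (mod 5)`) to an ARBITRARY partner:

* §1 `rank_sha_corank_partner`, `L_one_ne_zero_partner`: for primes `p ≡ 7 (mod 8)`, `q ≡ 3 (mod 8)`, `r ≡ 5 (mod 8)` with `(q/p) = −1`,
  `(r/p) = +1`, `p ∉ 𝔽_r^{×4}`, the twist `E = W_p⁻^{(−rq)} : y² = x³ − r²pq²·x` has rank `0`, `Ш[2] = 0`, `corank_{ℤ₂} Sel_{2^∞} = 0`
  (UNCONDITIONAL: `dim₂ S + dim₂ S′ = 2` by `…QuarticPartnerDescent/DescentDual`) and, modulo Burungale–Tian + Deuring–Hecke, `L(E,1) ≠ 0`;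
* §2 ★★ `cruxOnQuarticCornerPartner_of_two_facts` — THE GENERIC RUNG: for every partner prime `r ≡ 5 (mod 8)` and threshold `P` with
  `8⁸r⁵ ≤ (2.718·3.1415)⁸P³`, and every prime `p ≡ 7 (mod 8)`, `p ≥ P`, with `p` a square but not a fourth power modulo `r`: a Heegner
  field `K′ = ℚ(√−qr)` of `N(W_p⁻)` (`q < p` the UNCONDITIONAL three-squares pin `ternaryPinThreeMinus_of_mod_eight_eq_seven`: `q ≡ 3 (8)`,
  `(q/p) = −1`) with `4 < |d_{K′}|`, `L(W_p⁻^{(d_{K′})}, 1) ≠ 0`, `h(K′) < p` (class number formula lever `classNumber_lt_of_lever`,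
  `|d| = qr < r·p`) and `p ∤ h(K′)` — modulo Burungale–Tian (`hBT`) + Deuring–Hecke (`hH`) ONLY;
* §3 rungs `r = 13` (`P = 61`, `p mod 13 ∈ {4, 10, 12}`), `r = 29` (`P = 231`, `p mod 29 ∈ {4, 5, 6, 9, 13, 22, 28}`) and `r = 37`
  (`P = 346`, `p mod 37 ∈ {3, 4, 11, 21, 25, 27, 28, 30, 36}`) as instances; further rungs (`53`, P = 629; `61`, P = 795; …) are
  one-liners of §2 (with partner `5`, all `p ≡ 4 (mod 5)`, in `…QuarticTwistCorner`).

Coverage: each partner covers the `p` in `(r−1)/4` of the `r−1` classes mod `r`; partners are independent (CRT), so `k` rungs cover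
density `1 − (3/4)^k` of the habitat `p ≡ 7 (mod 8)` — never all `p` (crux memo QUARTIC-CORNER-w4g13.md: PRIME twists are blind,
quartic-residue `p` are blind for each partner). HONEST FRAMING: typed sub-corner rungs on one CM family (measure zero in «all CM `W`»);
the crux (residual C⁺) is untouched; 21381 is NOT closed by corner theorems; BSD is not proved by any of this. THEOREMS ONLY.
Supports stmt-BirchSwinnertonDyer-21381.
-/

noncomputable section

open scoped Classical NumberField

namespace Summit.BirchSwinnertonDyer.BirchSwinnertonDyer.Theorems.BiquadraticEisensteinDescentHeegnerTwistCouplingInSupplyQuarticPartnerCorner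

open _root_.WeierstrassCurve Literature.NumberTheory.EllipticCurves
open Summit.BirchSwinnertonDyer.BirchSwinnertonDyer.Theorems.BiquadraticEisensteinDescentHeegnerTwistCouplingInSupplyQuarticTwistLocal
open Summit.BirchSwinnertonDyer.BirchSwinnertonDyer.Theorems.BiquadraticEisensteinDescentHeegnerTwistCouplingInSupplyQuarticTwistCorner
open Summit.BirchSwinnertonDyer.BirchSwinnertonDyer.Theorems.BiquadraticEisensteinDescentHeegnerTwistCouplingInSupplyQuarticPartnerEuler
open Summit.BirchSwinnertonDyer.BirchSwinnertonDyer.Theorems.BiquadraticEisensteinDescentHeegnerTwistCouplingInSupplyPartnerLadder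
open Summit.BirchSwinnertonDyer.BirchSwinnertonDyer.Theorems.BiquadraticEisensteinDescentHeegnerTwistCouplingInSupplyThreeSquaresPinDual

/-! ## §1 The twist `E = W_p⁻^{(−rq)} : y² = x³ − r²pq²·x` -/

section Twist

variable {p q r : ℕ} [hp : Fact p.Prime] [hq : Fact q.Prime] [hr : Fact r.Prime]

/-- **Both Selmer sets have two elements**: `S(0, −r²pq²) = {1, −p}`, `S′ = S(0, 4r²pq²) = {1, p}`, so `dim₂ S = dim₂ S′ = 1`.
[cite: SilvermanAEC2009, Prop. X.4.9 and Prop. X.6.1] -/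
theorem twoIsogenySelmerRank_partner (hp8 : p % 8 = 7) (hq8 : q % 8 = 3) (hr8 : r % 8 = 5)
    (hnq : ¬ IsSquare ((q : ℤ) : ZMod p)) (hsr : IsSquare ((r : ℤ) : ZMod p)) (hp4 : ∀ t : ZMod r, t ^ 4 ≠ ((p : ℤ) : ZMod r)) :
    twoIsogenySelmerRank 0 (-(r ^ 2 * p * q ^ 2 : ℤ)) = 1 ∧ twoIsogenySelmerRank' 0 (-(r ^ 2 * p * q ^ 2 : ℤ)) = 1 := by
  have hP := hp.out
  have h1p : (1 : ℤ) ≠ -(p : ℤ) := by have := hP.one_lt; omega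
  have h1p' : (1 : ℤ) ≠ (p : ℤ) := by exact_mod_cast hP.one_lt.ne
  have hS : twoIsogenySelmerGroup 0 (-(r ^ 2 * p * q ^ 2 : ℤ)) = {1, -(p : ℤ)} := by
    ext d
    rw [Summit.BirchSwinnertonDyer.BirchSwinnertonDyer.Theorems.BiquadraticEisensteinDescentHeegnerTwistCouplingInSupplyQuarticPartnerDescent.mem_selmer_neg_iff
      hp8 hq8 hr8 hnq hsr hp4, Finset.mem_insert, Finset.mem_singleton]
  have hS' : twoIsogenySelmerGroup' 0 (-(r ^ 2 * p * q ^ 2 : ℤ)) = {1, (p : ℤ)} := by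
    rw [twoIsogenySelmerGroup'_eq, show (-2 * 0 : ℤ) = 0 by norm_num,
      show ((0 : ℤ) ^ 2 - 4 * (-(r ^ 2 * p * q ^ 2 : ℤ))) = 4 * r ^ 2 * p * q ^ 2 by ring]
    ext d
    rw [Summit.BirchSwinnertonDyer.BirchSwinnertonDyer.Theorems.BiquadraticEisensteinDescentHeegnerTwistCouplingInSupplyQuarticPartnerDescentDual.mem_selmer_pos_iff
      hp8 hq8 hr8 hnq hsr hp4, Finset.mem_insert, Finset.mem_singleton]
  refine ⟨?_, ?_⟩
  · rw [twoIsogenySelmerRank, hS, Finset.card_pair h1p]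
    exact Nat.log_pow Nat.one_lt_two 1
  · rw [twoIsogenySelmerRank'_eq, hS', Finset.card_pair h1p']
    exact Nat.log_pow Nat.one_lt_two 1

/-- ★ **`rank = 0`, `Ш[2] = 0`, `corank_{ℤ₂} Sel_{2^∞} = 0` for `E : y² = x³ − r²pq²·x`** under the partner hypotheses — UNCONDITIONAL
(sharp descent via `2`-isogeny, then Greenberg's identity). [cite: SilvermanAEC2009, Prop. X.4.7 and Thm. X.4.2(a); Prop. X.6.1]
[cite: Greenberg1999LNM, §1 pp. 54–57] -/
theorem rank_sha_corank_partner (hp8 : p % 8 = 7) (hq8 : q % 8 = 3) (hr8 : r % 8 = 5)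
    (hnq : ¬ IsSquare ((q : ℤ) : ZMod p)) (hsr : IsSquare ((r : ℤ) : ZMod p)) (hp4 : ∀ t : ZMod r, t ^ 4 ≠ ((p : ℤ) : ZMod r))
    [hE : (⟨0, ((0 : ℤ) : ℚ), 0, ((-(r ^ 2 * p * q ^ 2) : ℤ) : ℚ), 0⟩ : WeierstrassCurve ℚ).IsElliptic] :
    (⟨0, ((0 : ℤ) : ℚ), 0, ((-(r ^ 2 * p * q ^ 2) : ℤ) : ℚ), 0⟩ : WeierstrassCurve ℚ).mordellWeilRank = 0 ∧
    (∀ c ∈ (⟨0, ((0 : ℤ) : ℚ), 0, ((-(r ^ 2 * p * q ^ 2) : ℤ) : ℚ), 0⟩ : WeierstrassCurve ℚ).sha, 2 • c = 0 → c = 0) ∧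
    (⟨0, ((0 : ℤ) : ℚ), 0, ((-(r ^ 2 * p * q ^ 2) : ℤ) : ℚ), 0⟩ : WeierstrassCurve ℚ).selmerCorank 2 = 0 := by
  have hp0 : (p : ℤ) ≠ 0 := by exact_mod_cast hp.out.ne_zero
  have hq0 : (q : ℤ) ≠ 0 := by exact_mod_cast hq.out.ne_zero
  have hr0 : (r : ℤ) ≠ 0 := by exact_mod_cast hr.out.ne_zero
  have hb : (-(r ^ 2 * p * q ^ 2) : ℤ) ≠ 0 :=
    neg_ne_zero.mpr (mul_ne_zero (mul_ne_zero (pow_ne_zero 2 hr0) hp0) (pow_ne_zero 2 hq0))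
  have hab : (-(r ^ 2 * p * q ^ 2) : ℤ) * ((0 : ℤ) ^ 2 - 4 * (-(r ^ 2 * p * q ^ 2) : ℤ)) ≠ 0 := by
    refine mul_ne_zero hb ?_
    rw [show ((0 : ℤ) ^ 2 - 4 * (-(r ^ 2 * p * q ^ 2) : ℤ)) = 4 * (r ^ 2 * p * q ^ 2) by ring]
    exact mul_ne_zero (by norm_num) (neg_ne_zero.mp hb)
  haveI := isElliptic_halfModel hab
  obtain ⟨h1, h2⟩ := twoIsogenySelmerRank_partner hp8 hq8 hr8 hnq hsr hp4
  have hle : twoIsogenySelmerRank 0 (-(r ^ 2 * p * q ^ 2) : ℤ) + twoIsogenySelmerRank' 0 (-(r ^ 2 * p * q ^ 2) : ℤ) ≤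
      (⟨0, ((0 : ℤ) : ℚ), 0, ((-(r ^ 2 * p * q ^ 2) : ℤ) : ℚ), 0⟩ : WeierstrassCurve ℚ).mordellWeilRank + 2 := by
    rw [h1, h2]; omega
  obtain ⟨-, -, hsum⟩ := natCard_sha_inf_range_eq_one_of_selmerRank_add_le hab hle
  have hrank : (⟨0, ((0 : ℤ) : ℚ), 0, ((-(r ^ 2 * p * q ^ 2) : ℤ) : ℚ), 0⟩ : WeierstrassCurve ℚ).mordellWeilRank = 0 := by
    rw [h1, h2] at hsum; omega
  have hsha := forall_mem_sha_two_smul_eq_zero_of_selmerRank_add_le hab hle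
  haveI : Fact (Nat.Prime 2) := ⟨Nat.prime_two⟩
  refine ⟨hrank, hsha, ?_⟩
  rw [(⟨0, ((0 : ℤ) : ℚ), 0, ((-(r ^ 2 * p * q ^ 2) : ℤ) : ℚ), 0⟩ : WeierstrassCurve ℚ).selmerCorank_eq_mordellWeilRank_add_holds 2,
    hrank, (⟨0, ((0 : ℤ) : ℚ), 0, ((-(r ^ 2 * p * q ^ 2) : ℤ) : ℚ), 0⟩ : WeierstrassCurve ℚ).shaCorank_eq_zero_of_forall 2 hsha]

/-- ★ `r_an(E) = 0` and `L(E, 1) ≠ 0` for `E : y² = x³ − r²pq²·x` under the partner hypotheses, modulo Burungale–Tian (prime `2`, `j = 1728`)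
and Deuring–Hecke (`1728 ∈ maximalCMJInvariants`). [cite: BurungaleTian2026, Thm. 1.1] [cite: SilvermanATAEC1994, Ch. II Cor. 10.5.1] -/
theorem L_one_ne_zero_partner (hBT : burungaleTian_analyticRank_eq_zero_of_selmerCorank_eq_zero_of_hasCM)
    (hH : hasEntireLFunction_of_j_mem_maximalCMJInvariants) (hp8 : p % 8 = 7) (hq8 : q % 8 = 3) (hr8 : r % 8 = 5)
    (hnq : ¬ IsSquare ((q : ℤ) : ZMod p)) (hsr : IsSquare ((r : ℤ) : ZMod p)) (hp4 : ∀ t : ZMod r, t ^ 4 ≠ ((p : ℤ) : ZMod r))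
    [hE : (⟨0, ((0 : ℤ) : ℚ), 0, ((-(r ^ 2 * p * q ^ 2) : ℤ) : ℚ), 0⟩ : WeierstrassCurve ℚ).IsElliptic] :
    (⟨0, ((0 : ℤ) : ℚ), 0, ((-(r ^ 2 * p * q ^ 2) : ℤ) : ℚ), 0⟩ : WeierstrassCurve ℚ).analyticRank = 0 ∧
    (⟨0, ((0 : ℤ) : ℚ), 0, ((-(r ^ 2 * p * q ^ 2) : ℤ) : ℚ), 0⟩ : WeierstrassCurve ℚ).entireLFunction 1 ≠ 0 := by
  haveI : Fact (Nat.Prime 2) := ⟨Nat.prime_two⟩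
  have hb : (-(r ^ 2 * p * q ^ 2) : ℤ) ≠ 0 :=
    neg_ne_zero.mpr (mul_ne_zero (mul_ne_zero (pow_ne_zero 2 (by exact_mod_cast hr.out.ne_zero))
      (by exact_mod_cast hp.out.ne_zero)) (pow_ne_zero 2 (by exact_mod_cast hq.out.ne_zero)))
  obtain ⟨hj, hCM⟩ := j_and_hasCM_lit hb
  obtain ⟨-, -, hcor⟩ := rank_sha_corank_partner hp8 hq8 hr8 hnq hsr hp4
  have h0 := hBT _ hCM 2 hcor
  refine ⟨h0, (analyticRank_eq_zero_iff_holds (W := (⟨0, ((0 : ℤ) : ℚ), 0, ((-(r ^ 2 * p * q ^ 2) : ℤ) : ℚ), 0⟩ :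
    WeierstrassCurve ℚ)) (hH _ ?_)).1 h0⟩
  rw [hj]
  simp [maximalCMJInvariants]

end Twist

/-! ## §2 ★★ The generic rung: any partner `r ≡ 5 (mod 8)` -/

section Rung

/-- `(r/p) = +1` from `(p/r) = +1` for `r ≡ 1 (mod 4)`. [folklore] -/
theorem isSquare_partner_mod_p {p r : ℕ} [hp : Fact p.Prime] [hr : Fact r.Prime] (hr4 : r % 4 = 1) (hp2 : p ≠ 2) (hrp : r ≠ p)
    (h : IsSquare ((p : ℤ) : ZMod r)) : IsSquare ((r : ℤ) : ZMod p) := by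
  have hr0 : ((r : ℤ) : ZMod p) ≠ 0 := by
    intro h0
    have : (p : ℤ) ∣ r := (ZMod.intCast_zmod_eq_zero_iff_dvd r p).mp h0
    have : p ∣ r := by exact_mod_cast this
    exact hrp ((Nat.prime_dvd_prime_iff_eq hp.out hr.out).mp this).symm
  have hp0 : ((p : ℤ) : ZMod r) ≠ 0 := by
    intro h0
    have : (r : ℤ) ∣ p := (ZMod.intCast_zmod_eq_zero_iff_dvd p r).mp h0
    have : r ∣ p := by exact_mod_cast this
    exact hrp ((Nat.prime_dvd_prime_iff_eq hr.out hp.out).mp this)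
  have h1 : legendreSym r p = 1 := (legendreSym.eq_one_iff r hp0).mpr h
  have hrec := legendreSym.quadratic_reciprocity_one_mod_four (p := r) (q := p) hr4 hp2
  exact (legendreSym.eq_one_iff p hr0).mp (by rw [hrec, h1])

/-- ★★ **THE GENERIC PARTNER RUNG for `W_p⁻ : y² = x³ − px`, TWO NAMED FACTS.** For a partner prime `r ≡ 5 (mod 8)` and a threshold `P`
with `8⁸r⁵ ≤ (2.718·3.1415)⁸P³`: for every prime `p ≡ 7 (mod 8)`, `p ≥ P`, with `p` a square but not a fourth power modulo `r`, there is a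
Heegner field `K′ = ℚ(√−qr)` of `N(W_p⁻)` (`q < p` the three-squares pin, `q ≡ 3 (8)`, `(q/p) = −1`; `d ≡ 1 (8)`, `(d/p) = +1`) with
`4 < |d_{K′}|`, `L(W_p⁻^{(d_{K′})}, 1) ≠ 0` (sharp `2`-isogeny descent, UNCONDITIONAL, then Burungale–Tian at `2`), `h(K′) < p` (size:
`qr < r·p`) and `p ∤ h(K′)` — the CONCLUSION of crux 21381 for `W = W_p⁻`, modulo `hBT` + `hH` only. The binders `IsGloballyMinimal`,
`NeZero N` mirror the crux and are unused. [cite: BurungaleTian2026, Thm. 1.1] [cite: SilvermanAEC2009, Prop. X.4.9, Prop. X.4.7, Thm. X.4.2(a)]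
[cite: Oesterle1988Gauss, II §3 Proposition p. 57 (27)] -/
theorem cruxOnQuarticCornerPartner_of_two_facts (hBT : burungaleTian_analyticRank_eq_zero_of_selmerCorank_eq_zero_of_hasCM)
    (hH : hasEntireLFunction_of_j_mem_maximalCMJInvariants) {r : ℕ} (hr : r.Prime) (hr8 : r % 8 = 5) {P : ℕ}
    (hkey : (8 : ℝ) ^ 8 * ((r : ℕ) : ℝ) ^ 5 ≤ (2.718 * 3.1415) ^ 8 * (P : ℝ) ^ 3) :
    ∀ (p : ℕ) [Fact p.Prime] [(⟨0, 0, 0, -(p : ℚ), 0⟩ : WeierstrassCurve ℚ).IsElliptic]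
      [(⟨0, 0, 0, -(p : ℚ), 0⟩ : WeierstrassCurve ℚ).IsGloballyMinimal]
      [NeZero ((⟨0, 0, 0, -(p : ℚ), 0⟩ : WeierstrassCurve ℚ).conductorNorm ℤ)],
      p % 8 = 7 → P ≤ p → IsSquare ((p : ℤ) : ZMod r) → (∀ t : ZMod r, t ^ 4 ≠ ((p : ℤ) : ZMod r)) →
      ∃ (K : Type) (_ : Field K) (_ : NumberField K),
        IsImaginaryQuadratic K ∧ 4 < (NumberField.discr K).natAbs ∧
        SatisfiesHeegnerHypothesis ((⟨0, 0, 0, -(p : ℚ), 0⟩ : WeierstrassCurve ℚ).conductorNorm ℤ) K ∧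
        ((⟨0, 0, 0, -(p : ℚ), 0⟩ : WeierstrassCurve ℚ).quadraticTwist (NumberField.discr K : ℚ)).entireLFunction 1 ≠ 0 ∧
        NumberField.classNumber K < p ∧ ¬ p ∣ NumberField.classNumber K := by
  intro p hpF _ _ _ hp8 hPp hsq hp4
  have hp : p.Prime := hpF.out
  haveI : Fact r.Prime := ⟨hr⟩
  have hrp : r ≠ p := by
    rintro rfl
    exact hp4 0 (by rw [zero_pow four_ne_zero]; push_cast; rw [ZMod.natCast_self])
  have hsr : IsSquare ((r : ℤ) : ZMod p) := isSquare_partner_mod_p (by omega) (by rintro rfl; omega) hrp hsq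
  obtain ⟨q, hq, hqlt, hq8, hJq⟩ := ternaryPinThreeMinus_of_mod_eight_eq_seven p hp hp8
  haveI : Fact q.Prime := ⟨hq⟩
  have hnq : ¬ IsSquare ((q : ℤ) : ZMod p) := by
    rw [← legendreSym.eq_neg_one_iff p, jacobiSym.legendreSym.to_jacobiSym]; exact hJq
  have hr0 : ((r : ℤ) : ZMod p) ≠ 0 := by
    intro h0
    have : (p : ℤ) ∣ r := (ZMod.intCast_zmod_eq_zero_iff_dvd r p).mp h0
    have : p ∣ r := by exact_mod_cast this
    exact hrp ((Nat.prime_dvd_prime_iff_eq hp hr).mp this).symm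
  have hJr : jacobiSym (r : ℤ) p = 1 := by
    rw [← jacobiSym.legendreSym.to_jacobiSym, legendreSym.eq_one_iff p hr0]; exact hsr
  have hJ : jacobiSym (-((q * r : ℕ) : ℤ)) p = 1 := by
    rw [Nat.mul_comm]; exact jacobiSym_neg_mul_eq_one (by omega) hJr hJq
  have hxc : ((q * r : ℕ) : ℝ) < ((r : ℕ) : ℝ) * p := by
    have h1 : q * r < r * p := by have := hr.pos; nlinarith
    exact_mod_cast h1
  have hh := classNumber_lt_of_lever hq hr hr8 hxc hkey hPp
  obtain ⟨K, iF, iN, hK, hdK, hH', hcl⟩ := exists_witnessField_of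
    (N := (⟨0, 0, 0, -(p : ℚ), 0⟩ : WeierstrassCurve ℚ).conductorNorm ℤ) hq hq8 hr hr8 hJ hh
    (fun s hs hsN => eq_two_or_eq_of_prime_dvd_conductorNorm_W hp hs hsN)
  refine ⟨K, iF, iN, hK, ?_, hH', ?_, hcl, fun hdvd =>
    absurd (Nat.le_of_dvd (NumberField.classNumber_pos K) hdvd) (not_le.mpr hcl)⟩
  · rw [hdK, Int.natAbs_neg, Int.natAbs_natCast]
    have := hq.two_le
    have : 5 ≤ r := by have := hr.two_le; omega
    nlinarith
  · -- `W^{(−qr)} : y² = x³ − r²pq²x`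
    rw [hdK, quadraticTwist_W]
    rw [show (-((-((q * r : ℕ) : ℤ)) ^ 2 * p) : ℤ) = (-(r ^ 2 * p * q ^ 2) : ℤ) by push_cast; ring]
    have hb : (-(r ^ 2 * p * q ^ 2) : ℤ) ≠ 0 :=
      neg_ne_zero.mpr (mul_ne_zero (mul_ne_zero (pow_ne_zero 2 (by exact_mod_cast hr.ne_zero))
        (by exact_mod_cast hp.ne_zero)) (pow_ne_zero 2 (by exact_mod_cast hq.ne_zero)))
    have hab : (-(r ^ 2 * p * q ^ 2) : ℤ) * ((0 : ℤ) ^ 2 - 4 * (-(r ^ 2 * p * q ^ 2) : ℤ)) ≠ 0 := by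
      refine mul_ne_zero hb ?_
      rw [show ((0 : ℤ) ^ 2 - 4 * (-(r ^ 2 * p * q ^ 2) : ℤ)) = 4 * (r ^ 2 * p * q ^ 2) by ring]
      exact mul_ne_zero (by norm_num) (neg_ne_zero.mp hb)
    haveI := isElliptic_mk_of_ne_zero (F := ℚ) hab
    exact (L_one_ne_zero_partner hBT hH hp8 hq8 hr8 hnq hsr hp4).2

end Rung

/-! ## §3 Three rungs as instances: `r = 13`, `29`, `37` -/

section Rungs

/-- The squares that are not fourth powers modulo `13` are `4, 10, 12`. [folklore] -/
theorem classes_thirteen : ∀ a : ZMod 13, (a = 4 ∨ a = 10 ∨ a = 12) → IsSquare a ∧ ∀ t : ZMod 13, t ^ 4 ≠ a := by decide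

/-- The squares that are not fourth powers modulo `29` are `4, 5, 6, 9, 13, 22, 28`. [folklore] -/
theorem classes_twentyNine : ∀ a : ZMod 29, (a = 4 ∨ a = 5 ∨ a = 6 ∨ a = 9 ∨ a = 13 ∨ a = 22 ∨ a = 28) →
    IsSquare a ∧ ∀ t : ZMod 29, t ^ 4 ≠ a := by decide

/-- Cast of `p` into `ZMod r` through its residue. [folklore] -/
theorem intCast_natCast_zmod_eq_mod (p r : ℕ) : ((p : ℤ) : ZMod r) = ((p % r : ℕ) : ZMod r) := by
  push_cast
  rw [ZMod.natCast_mod]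

/-- ★ **Rung `r = 13`**: every prime `p ≡ 7 (mod 8)`, `p ≥ 61`, with `p mod 13 ∈ {4, 10, 12}` — the crux conclusion for `W_p⁻`, modulo
Burungale–Tian + Deuring–Hecke. [cite: BurungaleTian2026, Thm. 1.1] [cite: Oesterle1988Gauss, II §3 Proposition p. 57 (27)] -/
theorem cruxOnQuarticCornerThirteen_of_two_facts (hBT : burungaleTian_analyticRank_eq_zero_of_selmerCorank_eq_zero_of_hasCM)
    (hH : hasEntireLFunction_of_j_mem_maximalCMJInvariants) :
    ∀ (p : ℕ) [Fact p.Prime] [(⟨0, 0, 0, -(p : ℚ), 0⟩ : WeierstrassCurve ℚ).IsElliptic]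
      [(⟨0, 0, 0, -(p : ℚ), 0⟩ : WeierstrassCurve ℚ).IsGloballyMinimal]
      [NeZero ((⟨0, 0, 0, -(p : ℚ), 0⟩ : WeierstrassCurve ℚ).conductorNorm ℤ)],
      p % 8 = 7 → 61 ≤ p → (p % 13 = 4 ∨ p % 13 = 10 ∨ p % 13 = 12) →
      ∃ (K : Type) (_ : Field K) (_ : NumberField K),
        IsImaginaryQuadratic K ∧ 4 < (NumberField.discr K).natAbs ∧
        SatisfiesHeegnerHypothesis ((⟨0, 0, 0, -(p : ℚ), 0⟩ : WeierstrassCurve ℚ).conductorNorm ℤ) K ∧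
        ((⟨0, 0, 0, -(p : ℚ), 0⟩ : WeierstrassCurve ℚ).quadraticTwist (NumberField.discr K : ℚ)).entireLFunction 1 ≠ 0 ∧
        NumberField.classNumber K < p ∧ ¬ p ∣ NumberField.classNumber K := by
  intro p _ _ _ _ hp8 h61 h13
  have hcast : ((p : ℤ) : ZMod 13) = ((p % 13 : ℕ) : ZMod 13) := intCast_natCast_zmod_eq_mod p 13
  have hcl : ((p : ℤ) : ZMod 13) = 4 ∨ ((p : ℤ) : ZMod 13) = 10 ∨ ((p : ℤ) : ZMod 13) = 12 := by
    rw [hcast]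
    rcases h13 with h | h | h <;> rw [h] <;> simp
  obtain ⟨hsq, hp4⟩ := classes_thirteen _ hcl
  exact cruxOnQuarticCornerPartner_of_two_facts hBT hH (by norm_num) (by norm_num) (P := 61) (by norm_num) p hp8 h61 hsq hp4

/-- ★ **Rung `r = 29`**: every prime `p ≡ 7 (mod 8)`, `p ≥ 231`, with `p mod 29 ∈ {4, 5, 6, 9, 13, 22, 28}` — the crux conclusion for
`W_p⁻`, modulo Burungale–Tian + Deuring–Hecke. [cite: BurungaleTian2026, Thm. 1.1] [cite: Oesterle1988Gauss, II §3 Proposition p. 57 (27)] -/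
theorem cruxOnQuarticCornerTwentyNine_of_two_facts (hBT : burungaleTian_analyticRank_eq_zero_of_selmerCorank_eq_zero_of_hasCM)
    (hH : hasEntireLFunction_of_j_mem_maximalCMJInvariants) :
    ∀ (p : ℕ) [Fact p.Prime] [(⟨0, 0, 0, -(p : ℚ), 0⟩ : WeierstrassCurve ℚ).IsElliptic]
      [(⟨0, 0, 0, -(p : ℚ), 0⟩ : WeierstrassCurve ℚ).IsGloballyMinimal]
      [NeZero ((⟨0, 0, 0, -(p : ℚ), 0⟩ : WeierstrassCurve ℚ).conductorNorm ℤ)],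
      p % 8 = 7 → 231 ≤ p →
      (p % 29 = 4 ∨ p % 29 = 5 ∨ p % 29 = 6 ∨ p % 29 = 9 ∨ p % 29 = 13 ∨ p % 29 = 22 ∨ p % 29 = 28) →
      ∃ (K : Type) (_ : Field K) (_ : NumberField K),
        IsImaginaryQuadratic K ∧ 4 < (NumberField.discr K).natAbs ∧
        SatisfiesHeegnerHypothesis ((⟨0, 0, 0, -(p : ℚ), 0⟩ : WeierstrassCurve ℚ).conductorNorm ℤ) K ∧
        ((⟨0, 0, 0, -(p : ℚ), 0⟩ : WeierstrassCurve ℚ).quadraticTwist (NumberField.discr K : ℚ)).entireLFunction 1 ≠ 0 ∧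
        NumberField.classNumber K < p ∧ ¬ p ∣ NumberField.classNumber K := by
  intro p _ _ _ _ hp8 h231 h29
  have hcast : ((p : ℤ) : ZMod 29) = ((p % 29 : ℕ) : ZMod 29) := intCast_natCast_zmod_eq_mod p 29
  have hcl : ((p : ℤ) : ZMod 29) = 4 ∨ ((p : ℤ) : ZMod 29) = 5 ∨ ((p : ℤ) : ZMod 29) = 6 ∨ ((p : ℤ) : ZMod 29) = 9 ∨
      ((p : ℤ) : ZMod 29) = 13 ∨ ((p : ℤ) : ZMod 29) = 22 ∨ ((p : ℤ) : ZMod 29) = 28 := by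
    rw [hcast]
    rcases h29 with h | h | h | h | h | h | h <;> rw [h] <;> simp
  obtain ⟨hsq, hp4⟩ := classes_twentyNine _ hcl
  exact cruxOnQuarticCornerPartner_of_two_facts hBT hH (by norm_num) (by norm_num) (P := 231) (by norm_num) p hp8 h231 hsq hp4

/-- The squares that are not fourth powers modulo `37` are `3, 4, 11, 21, 25, 27, 28, 30, 36`. [folklore] -/
theorem classes_thirtySeven : ∀ a : ZMod 37,
    (a = 3 ∨ a = 4 ∨ a = 11 ∨ a = 21 ∨ a = 25 ∨ a = 27 ∨ a = 28 ∨ a = 30 ∨ a = 36) → IsSquare a ∧ ∀ t : ZMod 37, t ^ 4 ≠ a := by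
  decide

/-- ★ **Rung `r = 37`**: every prime `p ≡ 7 (mod 8)`, `p ≥ 346`, with `p mod 37 ∈ {3, 4, 11, 21, 25, 27, 28, 30, 36}` — the crux conclusion
for `W_p⁻`, modulo Burungale–Tian + Deuring–Hecke. [cite: BurungaleTian2026, Thm. 1.1] [cite: Oesterle1988Gauss, II §3 Proposition p. 57 (27)] -/
theorem cruxOnQuarticCornerThirtySeven_of_two_facts (hBT : burungaleTian_analyticRank_eq_zero_of_selmerCorank_eq_zero_of_hasCM)
    (hH : hasEntireLFunction_of_j_mem_maximalCMJInvariants) :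
    ∀ (p : ℕ) [Fact p.Prime] [(⟨0, 0, 0, -(p : ℚ), 0⟩ : WeierstrassCurve ℚ).IsElliptic]
      [(⟨0, 0, 0, -(p : ℚ), 0⟩ : WeierstrassCurve ℚ).IsGloballyMinimal]
      [NeZero ((⟨0, 0, 0, -(p : ℚ), 0⟩ : WeierstrassCurve ℚ).conductorNorm ℤ)],
      p % 8 = 7 → 346 ≤ p →
      (p % 37 = 3 ∨ p % 37 = 4 ∨ p % 37 = 11 ∨ p % 37 = 21 ∨ p % 37 = 25 ∨ p % 37 = 27 ∨ p % 37 = 28 ∨ p % 37 = 30 ∨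
        p % 37 = 36) →
      ∃ (K : Type) (_ : Field K) (_ : NumberField K),
        IsImaginaryQuadratic K ∧ 4 < (NumberField.discr K).natAbs ∧
        SatisfiesHeegnerHypothesis ((⟨0, 0, 0, -(p : ℚ), 0⟩ : WeierstrassCurve ℚ).conductorNorm ℤ) K ∧
        ((⟨0, 0, 0, -(p : ℚ), 0⟩ : WeierstrassCurve ℚ).quadraticTwist (NumberField.discr K : ℚ)).entireLFunction 1 ≠ 0 ∧
        NumberField.classNumber K < p ∧ ¬ p ∣ NumberField.classNumber K := by
  intro p _ _ _ _ hp8 h346 h37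
  have hcast : ((p : ℤ) : ZMod 37) = ((p % 37 : ℕ) : ZMod 37) := intCast_natCast_zmod_eq_mod p 37
  have hcl : ((p : ℤ) : ZMod 37) = 3 ∨ ((p : ℤ) : ZMod 37) = 4 ∨ ((p : ℤ) : ZMod 37) = 11 ∨ ((p : ℤ) : ZMod 37) = 21 ∨
      ((p : ℤ) : ZMod 37) = 25 ∨ ((p : ℤ) : ZMod 37) = 27 ∨ ((p : ℤ) : ZMod 37) = 28 ∨ ((p : ℤ) : ZMod 37) = 30 ∨
      ((p : ℤ) : ZMod 37) = 36 := by
    rw [hcast]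
    rcases h37 with h | h | h | h | h | h | h | h | h <;> rw [h] <;> simp
  obtain ⟨hsq, hp4⟩ := classes_thirtySeven _ hcl
  exact cruxOnQuarticCornerPartner_of_two_facts hBT hH (by norm_num) (by norm_num) (P := 346) (by norm_num) p hp8 h346 hsq hp4

end Rungs

end Summit.BirchSwinnertonDyer.BirchSwinnertonDyer.Theorems.BiquadraticEisensteinDescentHeegnerTwistCouplingInSupplyQuarticPartnerCorner

end
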